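import Summits.AtomisticToContinuum.HydrodynamicLimit.Theorems.OneFlightGossipEngineEnergyCurrentTailsPedigreeObjects
import Summits.AtomisticToContinuum.HydrodynamicLimit.Theorems.OneFlightGossipEngineEnergyCurrentTailsPedigreeAssemblyConstants
import Summits.AtomisticToContinuum.HydrodynamicLimit.Theorems.OneFlightGossipEngineEnergyCurrentTailsPedigreeAssemblyNull
import Summits.AtomisticToContinuum.HydrodynamicLimit.Theorems.OneFlightGossipEngineEnergyCurrentTailsPedigreeAssemblyInheritance
import Literature.MathematicalPhysics.KineticTheory.HardSphereEulerProofs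
import Literature.MathematicalPhysics.KineticTheory.HardSphereTwoTimePressure
import HarnessLib

/-!
# Census assembly of the line `pedigree-perpetuity` (crux `EnergyCurrentTails`, stmt-AtomisticToContinuum-9235)

Registered stub `stub_censusAssembly : LineageLedger → LevelInclusion → InitialEnergyTails →
NeutralRunTails → MergeIntakeTails → CensusDecay` of the skeleton
`Cruxes/EnergyCurrentTails/Lines/pedigree_perpetuity.lean` (lead c3; this file by the lead's c3 worker),
landed over the vocabulary file `…Theorems.OneFlightGossipEngineEnergyCurrentTailsPedigreeObjects` and the
three support files `…PedigreeAssemblyConstants` (real-analysis constants), `…PedigreeAssemblyNull`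
(level count = sum of level probabilities, Markov at `s = 0`, contact-at-time-`s` is null, abstract union
bound) and `…PedigreeAssemblyInheritance` (heir cascade + Markov for the inheritance channel).

## Proof

Frame: `σ₀ := min (min σ₀ʳᵘⁿ σ₀ᵐᵉʳᵍᵉ) ½`; for `t < T` take `(δ, Θe, C_r, ρ₁, N₀ʳ)` from `NeutralRunTails`,
`(Θ₀, B₁, N₀ᵐ)` from `MergeIntakeTails`, `(Θ*, ē, C_d)` from `InitialEnergyTails`; answer `Θ := Θ₀`,
`N₀ := max N₀ʳ N₀ᵐ` and the constant `B` of `census_constants`.  For `N ≥ N₀`, `s ∈ [0,t]`, `L ≥ 1`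
(`P := λ_N`, a probability law, `≪` Liouville, carried by the good set):
* `L < L₀`: census `≤ N + 1 ≤ B (N+1) L⁻⁴`;
* `s = 0`: Markov against the data tail energy (`lintegral_levelCount_zero_le`);
* `s > 0`, `L ≥ L₀`: per particle `i`, off the null events `goodᶜ` and "`i` in contact at time `s`"
  (`measure_participates_flow_eq_zero`), `LevelInclusion` (run allowance `m = m(L)`, block horizon
  `g₁ = g₁(N, L)` of `census_constants` / `exists_blockHorizon`) covers the level event by
  (R) `⋃_{g<g₁} {m+g+2 ≤ eblockLen g}` — price `Σ_g C_r ρ₁^{m+g+2} ≤ C_r ρ₁^{m+2}/(1-ρ₁)` (`NeutralRunTails`),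
  (Λ) `{LΘ₀/3 ≤ Λ} ⊆ {⌊L/3⌋Θ₀ ≤ Λ}` — price `B₁⁺/⌊L/3⌋⁵` (`MergeIntakeTails`),
  (I) the inheritance event — priced IN SUM over `i` by the heir cascade of `LineageLedgerSure`, the
  a.e.-measurability of `LineageMeasurable` and the data tail energy (`sum_measure_inheritance_le`),
  (D) `{LΘ₀/3 ≤ (1-δ)^{g₁} Σ‖v‖²} ⊆ {ē(N+1) + LΘ₀ ≤ Σ‖v‖²}` — price `e^{-LΘ₀/Θ*}` (data deviation);
  the union bound `sum_measure_le_of_cover` and the arithmetic of `census_constants` conclude.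
-/

noncomputable section

open MeasureTheory Set Filter
open scoped ENNReal InnerProductSpace BigOperators

namespace Summit.AtomisticToContinuum.HydrodynamicLimit.Theorems.EnergyCurrentTailsPedigree

open Literature.MathematicalPhysics.KineticTheory Literature.Analysis.FluidPDE

/-- Terminal weights lie in `[0,1]` when all shares do (clause K0 of the sure ledger). -/
theorem termWeight_mem_unitInterval {N : ℕ} (ε : ℝ) (γ : ℝ → Config N (Fin 3) T3) (i : Fin N)
    (s : ℝ) (h : ∀ n, 0 ≤ share ε γ i s n ∧ share ε γ i s n ≤ 1) :
    0 ≤ termWeight ε γ i s ∧ termWeight ε γ i s ≤ 1 := by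
  unfold termWeight weight
  exact ⟨Finset.prod_nonneg fun j _ => (h j).1,
    Finset.prod_le_one (fun j _ => (h j).1) fun j _ => (h j).2⟩

/-- **Registered stub `stub_censusAssembly`** (line `pedigree-perpetuity`, lead c3 reshape): the
probabilistic half of the census assembly — the lineage ledger, the sure level inclusion, the Gaussian
facts of the data and the two annealed lineage prices give the census decay `C⁺`. -/
theorem stub_censusAssembly : LineageLedger → LevelInclusion → InitialEnergyTails → NeutralRunTails → MergeIntakeTails → CensusDecay := by
  rintro ⟨hSure, hMeas⟩ hIncl hData hRuns hMerges a₀ θ₀ u₀ ha hθ hu ha0 hθ0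
  obtain ⟨Θs, hΘs, eb, heb, Cd, hCd, HD⟩ := hData a₀ θ₀ u₀ ha hθ hu ha0 hθ0
  obtain ⟨σr, hσr, HR⟩ := hRuns a₀ θ₀ u₀ ha hθ hu ha0 hθ0
  obtain ⟨σm, hσm, HM⟩ := hMerges a₀ θ₀ u₀ ha hθ hu ha0 hθ0
  refine ⟨min (min σr σm) (1 / 2), lt_min (lt_min hσr hσm) (by norm_num), ?_⟩
  intro σ hσ hσlt T ρ θ u hE Φ h0 t ht
  have hσr' : σ < σr := lt_of_lt_of_le hσlt ((min_le_left _ _).trans (min_le_left _ _))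
  have hσm' : σ < σm := lt_of_lt_of_le hσlt ((min_le_left _ _).trans (min_le_right _ _))
  have hσ2 : σ ≤ 1 / 2 := (lt_of_lt_of_le hσlt (min_le_right _ _)).le
  obtain ⟨δ, hδ, hδ1, Θe, Cr, hCr, ρ₁, hρ0, hρ1, Nr, HR'⟩ := HR σ hσ hσr' T ρ θ u hE Φ h0 t ht
  obtain ⟨Θ₀, hΘ₀, B₁, Nm, HM'⟩ := HM σ hσ hσm' T ρ θ u hE Φ h0 t ht
  obtain ⟨L₀, hL₀3, B, hB, Hsmall, Hzero, Hpos⟩ :=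
    census_constants hδ hδ1 hΘ₀ hΘs hCr hρ0 hρ1 hCd B₁ Θe
  refine ⟨Θ₀, hΘ₀, B, max Nr Nm, fun N hN s hs L hL => ?_⟩
  have hNr : Nr ≤ N := le_of_max_le_left hN
  have hNm : Nm ≤ N := le_of_max_le_right hN
  haveI := isProbabilityMeasure_localGibbsLaw ha hθ hu ha0 hθ0 hσ2 N (Φ N)
  set P := localGibbsLaw σ a₀ u₀ θ₀ N (Φ N) with hP
  have hn0 : (0 : ℝ) ≤ (N : ℝ) + 1 := by positivity
  have hL1 : (1 : ℝ) ≤ (L : ℝ) := by exact_mod_cast hL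
  have hx : 0 < (L : ℝ) * Θ₀ := by positivity
  have hPac : P ≪ liouville (Torus.geometry (Fin 3)) (N + 1) (hsDiameter σ N) :=
    localGibbsLaw_absolutelyContinuous σ a₀ u₀ θ₀ N (Φ N)
  have hPgood : ∀ᵐ z ∂P, z ∈ (Φ N).good := ae_mem_good_localGibbsLaw σ a₀ u₀ θ₀ N (Φ N)
  unfold census
  by_cases hLsmall : (L : ℝ) ≤ L₀
  · -- small levels: the trivial bound
    calc ∫⁻ z, (∑ l : Fin (N + 1), Set.indicator {v : V3 | (L : ℝ) * Θ₀ ≤ ‖v‖ ^ 2}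
            (fun _ => (1 : ℝ≥0∞)) (((Φ N).flow s z l).2)) ∂P
        ≤ ((N + 1 : ℕ) : ℝ≥0∞) := lintegral_levelCount_le_card (Φ N) P s _
      _ = ENNReal.ofReal ((N : ℝ) + 1) := by
          rw [← ENNReal.ofReal_natCast]; push_cast; rfl
      _ ≤ ENNReal.ofReal (B * ((N : ℝ) + 1) / (L : ℝ) ^ 4) :=
          ENNReal.ofReal_le_ofReal (Hsmall L hL hLsmall _ hn0)
  have hL₀L : L₀ ≤ (L : ℝ) := (not_le.1 hLsmall).le
  rcases hs.1.eq_or_lt with hs0 | hs0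
  · -- time zero: Markov against the data tail energy
    subst hs0
    have hdat := (HD σ hσ hσ2 N (Φ N) ((L : ℝ) * Θ₀) hx.le).2.1
    calc ∫⁻ z, (∑ l : Fin (N + 1), Set.indicator {v : V3 | (L : ℝ) * Θ₀ ≤ ‖v‖ ^ 2}
            (fun _ => (1 : ℝ≥0∞)) (((Φ N).flow 0 z l).2)) ∂P
        ≤ ENNReal.ofReal (Cd * ((N : ℝ) + 1) * Real.exp (-((L : ℝ) * Θ₀) / Θs) / ((L : ℝ) * Θ₀)) :=
          lintegral_levelCount_zero_le (Φ N) P hPgood hx hdat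
      _ ≤ ENNReal.ofReal (B * ((N : ℝ) + 1) / (L : ℝ) ^ 4) :=
          ENNReal.ofReal_le_ofReal (Hzero L hL _ hn0)
  -- positive times, large levels
  obtain ⟨h3Θe, m, hallow, Hbound⟩ := Hpos L hL₀L
  have hL3 : 3 ≤ L := by exact_mod_cast hL₀3.trans hL₀L
  obtain ⟨hq1, hq2, -⟩ := third_level hL3
  obtain ⟨g₁, hg₁⟩ := exists_blockHorizon hδ hx (show 0 ≤ eb * ((N : ℝ) + 1) by positivity)
  -- the four channels and the two null events
  set ε := hsDiameter σ N with hε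
  set A : Fin (N + 1) → Set (Config (N + 1) (Fin 3) T3) :=
    fun i => {z | (L : ℝ) * Θ₀ ≤ ‖((Φ N).flow s z i).2‖ ^ 2} with hA
  set R : Fin (N + 1) → Set (Config (N + 1) (Fin 3) T3) := fun i =>
    ⋃ g ∈ Finset.range g₁, {z | ((m + g + 2 : ℕ) : ℕ∞)
      ≤ eblockLen ε (fun r => (Φ N).flow r z) Θe δ i s g} with hR
  set Λ : Fin (N + 1) → Set (Config (N + 1) (Fin 3) T3) := fun i =>
    {z | (L : ℝ) * Θ₀ / 3 ≤ warmIntake ε (fun r => (Φ N).flow r z) Θ₀ i s} with hΛ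
  set I : Fin (N + 1) → Set (Config (N + 1) (Fin 3) T3) := fun i =>
    {z | (L : ℝ) * Θ₀ / 3 ≤ ‖(z (termCarrier ε (fun r => (Φ N).flow r z) i s)).2‖ ^ 2
      * termWeight ε (fun r => (Φ N).flow r z) i s} with hI
  set Col : Fin (N + 1) → Set (Config (N + 1) (Fin 3) T3) := fun i =>
    {z | Participates (Torus.geometry (Fin 3)) ε ((Φ N).flow s z) i} with hCol
  set D : Set (Config (N + 1) (Fin 3) T3) :=
    {z | (L : ℝ) * Θ₀ / 3 ≤ (1 - δ) ^ g₁ * ∑ l : Fin (N + 1), ‖(z l).2‖ ^ 2} with hD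
  -- prices
  have h1ρ : 0 < 1 - ρ₁ := by linarith
  have hPR : ∀ i, P (R i) ≤ ENNReal.ofReal (Cr * ρ₁ ^ (m + 2) / (1 - ρ₁)) := by
    intro i
    calc P (R i) ≤ ∑ g ∈ Finset.range g₁, P {z | ((m + g + 2 : ℕ) : ℕ∞)
            ≤ eblockLen ε (fun r => (Φ N).flow r z) Θe δ i s g} := measure_biUnion_finset_le _ _
      _ ≤ ∑ g ∈ Finset.range g₁, ENNReal.ofReal (Cr * ρ₁ ^ (m + g + 2)) :=
          Finset.sum_le_sum fun g _ => HR' N hNr s hs i g (m + g + 2)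
      _ = ENNReal.ofReal (∑ g ∈ Finset.range g₁, Cr * ρ₁ ^ (m + g + 2)) :=
          (ENNReal.ofReal_sum_of_nonneg fun g _ => by positivity).symm
      _ ≤ ENNReal.ofReal (Cr * ρ₁ ^ (m + 2) / (1 - ρ₁)) :=
          ENNReal.ofReal_le_ofReal (sum_run_price_le hCr hρ0 hρ1 m g₁)
  have hPΛ : ∀ i, P (Λ i) ≤ ENNReal.ofReal (max B₁ 0 / ((L / 3 : ℕ) : ℝ) ^ 5) := by
    intro i
    calc P (Λ i) ≤ P {z | ((L / 3 : ℕ) : ℝ) * Θ₀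
            ≤ warmIntake ε (fun r => (Φ N).flow r z) Θ₀ i s} := by
          refine measure_mono fun z hz => ?_
          refine Set.mem_setOf_eq ▸ (le_trans ?_ (Set.mem_setOf_eq ▸ hz))
          calc ((L / 3 : ℕ) : ℝ) * Θ₀ ≤ ((L : ℝ) / 3) * Θ₀ := mul_le_mul_of_nonneg_right hq2 hΘ₀.le
            _ = (L : ℝ) * Θ₀ / 3 := by ring
      _ ≤ ENNReal.ofReal (B₁ / ((L / 3 : ℕ) : ℝ) ^ 5) := HM' N hNm s hs i (L / 3) hq1
      _ ≤ ENNReal.ofReal (max B₁ 0 / ((L / 3 : ℕ) : ℝ) ^ 5) :=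
          ENNReal.ofReal_le_ofReal (div_le_div_of_nonneg_right (le_max_left _ _) (by positivity))
  have hPD : P D ≤ ENNReal.ofReal (Real.exp (-((L : ℝ) * Θ₀) / Θs)) := by
    calc P D ≤ P {z | eb * ((N : ℝ) + 1) + (L : ℝ) * Θ₀ ≤ ∑ l : Fin (N + 1), ‖(z l).2‖ ^ 2} :=
          measure_mono fun z hz => le_of_discount_le hδ1 hg₁ hz
      _ ≤ _ := (HD σ hσ hσ2 N (Φ N) ((L : ℝ) * Θ₀) hx.le).2.2
  have hPI : (∑ i, P (I i ∩ (Φ N).good)) ≤ ENNReal.ofReal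
      (Cd * ((N : ℝ) + 1) * Real.exp (-((L : ℝ) * Θ₀ / 3) / Θs) / ((L : ℝ) * Θ₀ / 3)) := by
    refine sum_measure_inheritance_le P (Φ N).good
      (fun i z => termCarrier ε (fun r => (Φ N).flow r z) i s)
      (fun i z => termWeight ε (fun r => (Φ N).flow r z) i s) (by positivity) (by positivity)
      (Φ N).measurableSet_good (fun i => ((hMeas σ N (Φ N) i s).2.1).mono_ac hPac)
      (fun i => ((hMeas σ N (Φ N) i s).2.2).mono_ac hPac) (fun z hz i => ?_) (fun z hz j => ?_) ?_
    · exact termWeight_mem_unitInterval ε _ i s ((hSure σ N (Φ N)).1 z hz i s hs0).1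
    · exact (hSure σ N (Φ N)).2 z hz s hs0 j
    · exact (HD σ hσ hσ2 N (Φ N) ((L : ℝ) * Θ₀ / 3) (by positivity)).2.1
  have hgood : P (Φ N).goodᶜ = 0 := ae_iff.1 hPgood
  have hcol : ∀ i, P (Col i) = 0 := fun i =>
    measure_participates_flow_eq_zero (hsDiameter_pos hσ N).ne' (Φ N) P hPac s i
  -- the cover by `LevelInclusion`
  have hcover : ∀ i, ∀ z ∈ (Φ N).good, z ∉ Col i → z ∈ A i →
      z ∈ R i ∨ z ∈ Λ i ∨ z ∈ I i ∨ z ∈ D := by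
    intro i z hz hzc hzA
    rcases hIncl σ N (Φ N) z hz i s hs0 hzc δ Θ₀ Θe (L : ℝ) m g₁ hδ hδ1 hΘ₀ (hallow g₁) h3Θe hzA
      with ⟨g, hg, hge⟩ | h | h | h
    · refine Or.inl ?_
      simp only [hR, Set.mem_iUnion, Finset.mem_range, exists_prop]
      exact ⟨g, hg, hge⟩
    · exact Or.inr (Or.inl h)
    · exact Or.inr (Or.inr (Or.inl h))
    · exact Or.inr (Or.inr (Or.inr h))
  -- assemble
  rw [lintegral_levelCount_eq_sum]
  calc (∑ l : Fin (N + 1), P {z | (L : ℝ) * Θ₀ ≤ ‖((Φ N).flow s z l).2‖ ^ 2})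
      ≤ ENNReal.ofReal (((N + 1 : ℕ) : ℝ) * (Cr * ρ₁ ^ (m + 2) / (1 - ρ₁)
          + max B₁ 0 / ((L / 3 : ℕ) : ℝ) ^ 5 + Real.exp (-((L : ℝ) * Θ₀) / Θs))
          + Cd * ((N : ℝ) + 1) * Real.exp (-((L : ℝ) * Θ₀ / 3) / Θs) / ((L : ℝ) * Θ₀ / 3)) :=
        sum_measure_le_of_cover P A R Λ I Col (Φ N).good D (by positivity) (by positivity)
          (by positivity) (by positivity) hgood hcol hcover hPR hPΛ hPD hPI
    _ ≤ ENNReal.ofReal (B * ((N : ℝ) + 1) / (L : ℝ) ^ 4) := by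
        refine ENNReal.ofReal_le_ofReal ?_
        push_cast
        exact Hbound _ hn0

end Summit.AtomisticToContinuum.HydrodynamicLimit.Theorems.EnergyCurrentTailsPedigree

end
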